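import Mathlib
import Summits.ValiantsHypothesis.ValiantsHypothesis.Theorems.GeneratorObstructionsPowGenDegreeQPWideRegime
import Summits.ValiantsHypothesis.ValiantsHypothesis.Theorems.GeneratorObstructionsPerGenDegreeSuperQPRectangularAtom

/-!
# Route GeneratorObstructions — crux K2 `PowGenDegreeQP` (stmt-ValiantsHypothesis-11655), line
# `trace-side-regimes`: WIDE ATOMS — the first concrete content of `stub_wideGen`

Helper file (`--supports stmt-ValiantsHypothesis-11655`), continuing
`GeneratorObstructionsPowGenDegreeQPWideRegime` (wide occurring weights of `ℂ[Δ_m[tr X_{m+e}^m]]`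
have more than `m²` nonzero entries and degree `≥ m² + 1`).  Here: where wide GENERATOR TYPES come
from, unconditionally in structure and conditionally in existence.

1. `finrank_quotient_ne_zero_of_atom` — **atoms are generator types**, for an arbitrary form `f` on a
   finite linearly ordered alphabet `σ` and inner degree `n ≠ 0` (the landed `stub_atomGen` of K1 is
   the instance `f = per_m`): at an atom `χ` of the occurrence monoid every summand
   `HWV_χ₁ · HWV_χ₂` of the decomposable part has a `⊥` factor, so `γ_χ = dim HWV_χ ≠ 0`
   (finite-dimensional by BLMW 2011 §5.2, tree `finiteDimensional_highestWeightSpace_orbitCoordRep_holds`).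
2. `exists_least_const_atom` — **the least occurring constant weight is an atom** (general `f`, `σ`):
   if some `-k·𝟙` (`k > 0`) occurs in `ℂ[Δ_n[f]]`, the least such `-k₀·𝟙` has no splitting into two
   nonzero occurring weights (dominant summands of a constant weight are constant,
   `apply_eq_apply_of_isDominant_add_eq_const`; minimality).  Occurring constant weights are the
   restrictions of `SL_σ`-invariants of `Sym^n` not vanishing at `f` (BI 2017 §3.3, the degree monoid
   `E(f)`; tree `MinimalDegree` for `per`), so `k₀ |σ| / n = e(f)` is the least degree of an
   `SL`-invariant detecting `f` — not used formally here.
3. `exists_wide_genType_of_hasHighestWeight_const` — for K2's ring with `e ≥ 1`: if some positive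
   constant weight occurs in `ℂ[Δ_m[tr X_{m+e}^m]]`, the least one is a WIDE generator type (all
   `(m+e)² > m²` entries nonzero, `γ ≠ 0`) of size `-k₀ (m+e)²`, i.e. degree `k₀ (m+e)²/m ≥ (m+e)²`.
4. Consequences for the stub (`stub_wideGen` verbatim as hypothesis / negated conclusion):
   `wideGen_bounds_least_const` — the stub forces, throughout the window with `e ≥ 1`, the least
   occurring constant weight `-k₀·𝟙` of `tr X_{m+e}^m` (when one occurs) to satisfy
   `k₀ (m+e)² ≤ m · 2^((log₂ m + c₀)^c₀)`: **quasi-polynomial nullcone-separation degree for power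
   traces inside the window**; `not_wideGen_of_late_const`, `not_powGenDegreeQP_of_late_const` — a
   window family whose least occurring constant weight is super-quasi-polynomially late REFUTES
   `stub_wideGen` and K2.  (Whether a constant weight occurs at all for `e ≥ 1`, i.e. whether
   `tr X_n^m` is `SL_{n²}`-semistable for `n > m ≥ 2`, is Kempf-type GIT as in the tree's
   `MS2001TracePowerPolystable` for `n = m`; not proved here — the statements are conditional on
   occurrence.)

Honest framing: structure lemmas and implications between OPEN statements; `stub_wideGen`,
`stub_sliceGen`, K2, K1, `GenFlipThesis` remain open and `VP ≠ VNP` is not touched.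

References: Bürgisser–Landsberg–Manivel–Weyman, SIAM J. Comput. 40 (2011) §5.2;
Bürgisser–Ikenmeyer, *Fundamental invariants of orbit closures*, J. Algebra 477 (2017) §3.3;
Mulmuley–Sohoni, SIAM J. Comput. 31 (2001) §4.1 (Remark after Thm. 4.6).
-/

namespace Summit.ValiantsHypothesis.ValiantsHypothesis.Theorems.GeneratorObstructions.PowGenDegreeQP

open MvPolynomial
open Literature.NumberTheory.DiophantineGeometry Literature.Computability.AlgebraicComplexity
open Summit.ValiantsHypothesis.ValiantsHypothesis.Theses.GeneratorObstructions
open Summit.ValiantsHypothesis.ValiantsHypothesis.Theorems.GenInheritance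
open Summit.ValiantsHypothesis.ValiantsHypothesis.Theorems.GeneratorObstructions.SliceTransfer
open Summit.ValiantsHypothesis.ValiantsHypothesis.Theorems.GeneratorObstructions.PerGenDegreeSuperQP

-- `Summit.ValiantsHypothesis.ValiantsHypothesis.…` is the tree's mandated single-conjunct layout.
set_option linter.dupNamespace false

noncomputable section

/-! ## 1. Atoms are generator types (general form) -/

section General

variable {σ : Type*} [Fintype σ] [LinearOrder σ]

/-- **Atoms of the occurrence monoid are generator types** (general form of the landed
`stub_atomGen`): for a form `f` on `σ`, inner degree `n ≠ 0`, and an OCCURRING weight `χ` of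
`ℂ[Δ_n[f]]` every splitting `χ = χ₁ + χ₂` of which into nonzero weights has a non-occurring summand,
`γ_χ = dim (HWV_χ ⧸ HWV_χ ∩ Σ HWV_χ₁ · HWV_χ₂) ≠ 0`. [cite: BurgisserEtAl2011, §5.2] -/
theorem finrank_quotient_ne_zero_of_atom (f : MvPolynomial σ ℂ) {n : ℕ} (hn : n ≠ 0) {χ : Weight σ}
    (hne : highestWeightSpace (orbitCoordRep f n) χ ≠ ⊥)
    (hatom : ∀ χ₁ χ₂ : Weight σ, χ₁ + χ₂ = χ → χ₁ ≠ 0 → χ₂ ≠ 0 →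
      highestWeightSpace (orbitCoordRep f n) χ₁ = ⊥ ∨ highestWeightSpace (orbitCoordRep f n) χ₂ = ⊥) :
    Module.finrank ℂ (↥(highestWeightSpace (orbitCoordRep f n) χ) ⧸
      Submodule.comap (highestWeightSpace (orbitCoordRep f n) χ).subtype
        (⨆ p : Weight σ × Weight σ, ⨆ (_ : p.1 + p.2 = χ ∧ p.1 ≠ 0 ∧ p.2 ≠ 0),
          highestWeightSpace (orbitCoordRep f n) p.1 * highestWeightSpace (orbitCoordRep f n) p.2)) ≠ 0 := by
  classical
  haveI : Infinite ℂ := CharZero.infinite ℂ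
  have hdec : (⨆ p : Weight σ × Weight σ, ⨆ (_ : p.1 + p.2 = χ ∧ p.1 ≠ 0 ∧ p.2 ≠ 0),
      highestWeightSpace (orbitCoordRep f n) p.1 * highestWeightSpace (orbitCoordRep f n) p.2) = ⊥ := by
    refine iSup_eq_bot.2 fun p => iSup_eq_bot.2 fun hp => ?_
    rcases hatom p.1 p.2 hp.1 hp.2.1 hp.2.2 with h1 | h2
    · rw [h1, Submodule.bot_mul]
    · rw [h2, Submodule.mul_bot]
  rw [hdec, Submodule.comap_bot, Submodule.ker_subtype]
  haveI := finiteDimensional_highestWeightSpace_orbitCoordRep_holds f (m := n) hn χ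
  haveI : Nontrivial (highestWeightSpace (orbitCoordRep f n) χ) := Submodule.nontrivial_iff_ne_bot.2 hne
  rw [(Submodule.quotEquivOfEqBot _ rfl).finrank_eq]
  exact Module.finrank_pos.ne'

/-- **The least occurring constant weight is an atom** (general form of the landed
`per_exists_least_const_atom`): if some constant weight `-k·𝟙`, `k > 0`, occurs in `ℂ[Δ_n[f]]`, then
for the least such `k₀` the weight `-k₀·𝟙` occurs, no `-k·𝟙` with `0 < k < k₀` occurs, and
`-k₀·𝟙` has no splitting into two nonzero occurring weights — occurring weights are dominant and
`≤ 0`, two dominant summands of a constant weight are constant, and a proper constant summand would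
be an earlier occurring constant weight. [cite: BurgisserIkenmeyer2017, §3.3] -/
theorem exists_least_const_atom (f : MvPolynomial σ ℂ) (n : ℕ)
    (hex : ∃ k : ℕ, 0 < k ∧ highestWeightSpace (orbitCoordRep f n) (fun _ : σ => -(k : ℤ)) ≠ ⊥) :
    ∃ k₀ : ℕ, 0 < k₀ ∧
      highestWeightSpace (orbitCoordRep f n) (fun _ : σ => -(k₀ : ℤ)) ≠ ⊥ ∧
      (∀ k : ℕ, 0 < k → k < k₀ →
        highestWeightSpace (orbitCoordRep f n) (fun _ : σ => -(k : ℤ)) = ⊥) ∧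
      (∀ χ₁ χ₂ : Weight σ, χ₁ + χ₂ = (fun _ : σ => -(k₀ : ℤ)) → χ₁ ≠ 0 → χ₂ ≠ 0 →
        highestWeightSpace (orbitCoordRep f n) χ₁ = ⊥ ∨
          highestWeightSpace (orbitCoordRep f n) χ₂ = ⊥) := by
  classical
  haveI : Infinite ℂ := CharZero.infinite ℂ
  set k₀ := Nat.find hex with hk₀
  obtain ⟨hk₀pos, hocc⟩ := Nat.find_spec hex
  have hmin : ∀ k : ℕ, 0 < k → k < k₀ →
      highestWeightSpace (orbitCoordRep f n) (fun _ : σ => -(k : ℤ)) = ⊥ := by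
    intro k hk hlt
    by_contra hne
    exact Nat.find_min hex hlt ⟨hk, hne⟩
  refine ⟨k₀, hk₀pos, hocc, hmin, ?_⟩
  intro χ₁ χ₂ hsum h1 h2
  by_contra hne
  rw [not_or] at hne
  obtain ⟨hne1, hne2⟩ := hne
  have h1' : HasHighestWeight (orbitCoordRep f n) χ₁ := hne1
  have h2' : HasHighestWeight (orbitCoordRep f n) χ₂ := hne2
  obtain ⟨hle1, -⟩ := nonpos_and_exists_size_eq_of_hasHighestWeight_orbitCoordRep _ h1'
  obtain ⟨hle2, -⟩ := nonpos_and_exists_size_eq_of_hasHighestWeight_orbitCoordRep _ h2'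
  have hdom1 := isDominant_of_hasHighestWeight_orbitCoordRep _ h1'
  have hdom2 := isDominant_of_hasHighestWeight_orbitCoordRep _ h2'
  have hc1 := apply_eq_apply_of_isDominant_add_eq_const hdom1 hdom2 hsum
  have hc2 := apply_eq_apply_of_isDominant_add_eq_const hdom2 hdom1
    (by rw [add_comm]; exact hsum)
  -- an index where `χ₁` is nonzero (exists since `χ₁ ≠ 0`)
  obtain ⟨t, ht⟩ : ∃ t, χ₁ t ≠ 0 := by
    by_contra hall
    push Not at hall
    exact h1 (funext fun x => by rw [hall x]; rfl)
  have hχ1 : χ₁ = fun _ => χ₁ t := funext fun x => hc1 x t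
  have hχ2 : χ₂ = fun _ => χ₂ t := funext fun x => hc2 x t
  have hc2ne : χ₂ t ≠ 0 := fun h0 => h2 (by rw [hχ2, h0]; rfl)
  have hst := congrFun hsum t
  simp only [Pi.add_apply] at hst
  have hc1le := hle1 t
  have hc2le := hle2 t
  obtain ⟨k₁, hk₁⟩ : ∃ k₁ : ℕ, χ₁ t = -(k₁ : ℤ) := ⟨(-χ₁ t).toNat, by omega⟩
  have hk₁pos : 0 < k₁ := by omega
  have hk₁lt : k₁ < k₀ := by omega
  apply hne1
  rw [hχ1, hk₁]
  exact hmin k₁ hk₁pos hk₁lt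

omit [LinearOrder σ] in
/-- The size of the constant weight `-k·𝟙` on `σ` is `-k |σ|`. [folklore] -/
theorem size_const_neg (k : ℕ) :
    Weight.size (fun _ : σ => -(k : ℤ)) = -((k * Fintype.card σ : ℕ) : ℤ) := by
  rw [Weight.size, Finset.sum_const, Finset.card_univ, nsmul_eq_mul]
  push_cast
  ring

end General

/-! ## 2. Wide generator types of `ℂ[Δ_m[tr X_{m+e}^m]]` from occurring constant weights -/

section WideAtoms

variable {m e : ℕ}

/-- For `e ≥ 1` a final segment `ι : MatIdx m → MatIdx (m + e)` is not onto: some letter of the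
`(m+e)²` lies off its range. [folklore] -/
theorem exists_not_mem_range_of_one_le (he : 1 ≤ e) (ι : MatIdx m → MatIdx (m + e)) :
    ∃ x : MatIdx (m + e), x ∉ Set.range ι := by
  classical
  by_contra hall
  push Not at hall
  have hsurj : Function.Surjective ι := fun x => hall x
  have hcard := Fintype.card_le_of_surjective ι hsurj
  rw [Fintype.card_lex, Fintype.card_prod, Fintype.card_fin, Fintype.card_lex, Fintype.card_prod,
    Fintype.card_fin] at hcard
  nlinarith

/-- **Wide generator types from constant weights.** Let `1 ≤ m`, `1 ≤ e`, `ι` a final segment, and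
suppose some constant weight `-k·𝟙` (`k > 0`) occurs in `ℂ[Δ_m[tr X_{m+e}^m]]`. Then the least such,
`χ₀ = -k₀·𝟙`, is a WIDE GENERATOR TYPE: it has a nonzero entry off `range ι` (all its `(m+e)²`
entries are `-k₀ ≠ 0`), `γ_{χ₀} ≠ 0` (least constant weight ⇒ atom ⇒ generator type), and
`-|χ₀| = k₀ (m+e)²`. [cite: BurgisserIkenmeyer2017, §3.3] -/
theorem exists_wide_genType_of_hasHighestWeight_const (hm : 1 ≤ m) (he : 1 ≤ e)
    {ι : MatIdx m → MatIdx (m + e)}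
    (hex : ∃ k : ℕ, 0 < k ∧
      highestWeightSpace (orbitCoordRep (powFormLex ℂ (m + e) m) m) (fun _ => -(k : ℤ)) ≠ ⊥) :
    ∃ k₀ : ℕ, 0 < k₀ ∧
      highestWeightSpace (orbitCoordRep (powFormLex ℂ (m + e) m) m) (fun _ => -(k₀ : ℤ)) ≠ ⊥ ∧
      (∀ k : ℕ, 0 < k → k < k₀ →
        highestWeightSpace (orbitCoordRep (powFormLex ℂ (m + e) m) m) (fun _ => -(k : ℤ)) = ⊥) ∧
      (∃ x, x ∉ Set.range ι ∧ (fun _ : MatIdx (m + e) => -(k₀ : ℤ)) x ≠ 0) ∧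
      Module.finrank ℂ (↥(highestWeightSpace (orbitCoordRep (powFormLex ℂ (m + e) m) m) (fun _ => -(k₀ : ℤ))) ⧸
        Submodule.comap (highestWeightSpace (orbitCoordRep (powFormLex ℂ (m + e) m) m) (fun _ => -(k₀ : ℤ))).subtype
          (⨆ p : Weight (MatIdx (m + e)) × Weight (MatIdx (m + e)),
            ⨆ (_ : p.1 + p.2 = (fun _ => -(k₀ : ℤ)) ∧ p.1 ≠ 0 ∧ p.2 ≠ 0),
            highestWeightSpace (orbitCoordRep (powFormLex ℂ (m + e) m) m) p.1 *
              highestWeightSpace (orbitCoordRep (powFormLex ℂ (m + e) m) m) p.2)) ≠ 0 ∧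
      -(Weight.size (fun _ : MatIdx (m + e) => -(k₀ : ℤ))) = (k₀ : ℤ) * (((m + e) * (m + e) : ℕ) : ℤ) := by
  classical
  obtain ⟨k₀, hk₀pos, hocc, hmin, hatom⟩ := exists_least_const_atom (powFormLex ℂ (m + e) m) m hex
  obtain ⟨x, hx⟩ := exists_not_mem_range_of_one_le he ι
  refine ⟨k₀, hk₀pos, hocc, hmin, ⟨x, hx, ?_⟩, ?_, ?_⟩
  · simp only [ne_eq, neg_eq_zero, Nat.cast_eq_zero]
    exact hk₀pos.ne'
  · exact finrank_quotient_ne_zero_of_atom (powFormLex ℂ (m + e) m) (by omega) hocc hatom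
  · rw [size_const_neg, Fintype.card_lex, Fintype.card_prod, Fintype.card_fin, neg_neg]
    push_cast
    ring

/-- **Occurring constant weights are at least `m`**: if `-k·𝟙` (`k > 0`) occurs in
`ℂ[Δ_m[tr X_{m+e}^m]]` then `m ≤ k` — by `ℓ(λ) ≤ deg` (tree `card_filter_ne_zero_le_degree`,
Macdonald I.8 Ex. 9) the degree `D = k (m+e)²/m` is at least the number `(m+e)²` of nonzero entries.
So a wide atom of this kind has degree `≥ (m+e)²`. [cite: Macdonald1995, Ch. I §8 Example 9] -/
theorem le_of_hasHighestWeight_const (hm : 1 ≤ m) {k : ℕ} (hk : 0 < k)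
    (hocc : highestWeightSpace (orbitCoordRep (powFormLex ℂ (m + e) m) m) (fun _ => -(k : ℤ)) ≠ ⊥) :
    m ≤ k := by
  classical
  haveI : Infinite ℂ := CharZero.infinite ℂ
  have h' : HasHighestWeight (orbitCoordRep (powFormLex ℂ (m + e) m) m) (fun _ => -(k : ℤ)) := hocc
  obtain ⟨-, D, hD⟩ := nonpos_and_exists_size_eq_of_hasHighestWeight_orbitCoordRep _ h'
  have hlen := card_filter_ne_zero_le_degree (powFormLex ℂ (m + e) m) (by omega)
    (powFormLex_isHomogeneous ℂ (m + e) m) hocc hD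
  have hcard : (Finset.univ.filter fun x : MatIdx (m + e) =>
      (fun _ : MatIdx (m + e) => -(k : ℤ)) x ≠ 0).card = (m + e) * (m + e) := by
    rw [Finset.filter_true_of_mem fun x _ => ?_, Finset.card_univ, Fintype.card_lex,
      Fintype.card_prod, Fintype.card_fin]
    simp only [ne_eq, neg_eq_zero, Nat.cast_eq_zero]
    exact hk.ne'
  rw [hcard] at hlen
  have hsz := size_const_neg (σ := MatIdx (m + e)) k
  rw [Fintype.card_lex, Fintype.card_prod, Fintype.card_fin, hD, neg_inj, Nat.cast_inj] at hsz
  -- `m * D = k * (m+e)²` and `(m+e)² ≤ D`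
  have h1 : m * ((m + e) * (m + e)) ≤ m * D := Nat.mul_le_mul_left m hlen
  rw [hsz] at h1
  exact Nat.le_of_mul_le_mul_right h1 (by positivity)

end WideAtoms

/-! ## 3. Consequences for `stub_wideGen` and K2 -/

section Stub

/-- **`stub_wideGen` bounds the least occurring constant weight quasi-polynomially.** If the
registered `stub_wideGen` holds (hypothesis verbatim), then for every `c` there is `c₀` such that for
all `1 ≤ m`, `1 ≤ e`, `m + e ≤ 2^((log₂ m + c)^c)`: whenever SOME constant weight `-k·𝟙` (`k > 0`)
occurs in `ℂ[Δ_m[tr X_{m+e}^m]]`, some occurring one has `k (m+e)² ≤ m · 2^((log₂ m + c₀)^c₀)` (the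
least one, a wide generator type by `exists_wide_genType_of_hasHighestWeight_const`).  In the language
of BI 2017 §3.3: the least degree of an `SL_{(m+e)²}`-invariant of `Sym^m ℂ^{(m+e)²}` not vanishing at
`tr X_{m+e}^m` — when finite — is quasi-polynomially bounded throughout the window.
[cite: BurgisserIkenmeyer2017, §3.3] -/
theorem wideGen_bounds_least_const
    (hW : ∀ c : ℕ, ∃ c₀ : ℕ, ∀ m e : ℕ, 1 ≤ m → m + e ≤ 2 ^ ((Nat.log 2 m + c) ^ c) →
      ∀ ι : MatIdx m → MatIdx (m + e), StrictMono ι → IsUpperSet (Set.range ι) →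
        ∀ χ : Weight (MatIdx (m + e)), (∃ x, x ∉ Set.range ι ∧ χ x ≠ 0) →
          Module.finrank ℂ (↥(highestWeightSpace (orbitCoordRep (powFormLex ℂ (m + e) m) m) (χ)) ⧸ Submodule.comap (highestWeightSpace (orbitCoordRep (powFormLex ℂ (m + e) m) m) (χ)).subtype (⨆ p : Weight (MatIdx (m + e)) × Weight (MatIdx (m + e)), ⨆ (_ : p.1 + p.2 = (χ) ∧ p.1 ≠ 0 ∧ p.2 ≠ 0), highestWeightSpace (orbitCoordRep (powFormLex ℂ (m + e) m) m) p.1 * highestWeightSpace (orbitCoordRep (powFormLex ℂ (m + e) m) m) p.2)) ≠ 0 →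
            -(Weight.size χ) ≤ (m : ℤ) * 2 ^ ((Nat.log 2 m + c₀) ^ c₀)) :
    ∀ c : ℕ, ∃ c₀ : ℕ, ∀ m e : ℕ, 1 ≤ m → 1 ≤ e → m + e ≤ 2 ^ ((Nat.log 2 m + c) ^ c) →
      (∃ k : ℕ, 0 < k ∧
        highestWeightSpace (orbitCoordRep (powFormLex ℂ (m + e) m) m) (fun _ => -(k : ℤ)) ≠ ⊥) →
      ∃ k : ℕ, 0 < k ∧
        highestWeightSpace (orbitCoordRep (powFormLex ℂ (m + e) m) m) (fun _ => -(k : ℤ)) ≠ ⊥ ∧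
        (∀ k' : ℕ, 0 < k' → k' < k →
          highestWeightSpace (orbitCoordRep (powFormLex ℂ (m + e) m) m) (fun _ => -(k' : ℤ)) = ⊥) ∧
        (k : ℤ) * (((m + e) * (m + e) : ℕ) : ℤ) ≤ (m : ℤ) * 2 ^ ((Nat.log 2 m + c₀) ^ c₀) := by
  intro c
  obtain ⟨c₀, hc₀⟩ := hW c
  refine ⟨c₀, fun m e hm he hwin hex => ?_⟩
  obtain ⟨ι, hι, hup⟩ := exists_finalSegment (n := m) (n' := m + e) (Nat.le_add_right m e)
  obtain ⟨k₀, hk₀pos, hocc, hmin, hwide, hγ, hsize⟩ :=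
    exists_wide_genType_of_hasHighestWeight_const (ι := ι) hm he hex
  refine ⟨k₀, hk₀pos, hocc, hmin, ?_⟩
  rw [← hsize]
  exact hc₀ m e hm hwin ι hι hup _ hwide hγ

/-- **A late least constant weight refutes `stub_wideGen`.** If for some `c` and every `c₀` there is a
window cell `1 ≤ m`, `1 ≤ e`, `m + e ≤ 2^((log₂ m + c)^c)` in which some positive constant weight of
`ℂ[Δ_m[tr X_{m+e}^m]]` occurs but EVERY occurring `-k·𝟙` (`k > 0`) has
`k (m+e)² > m · 2^((log₂ m + c₀)^c₀)` (super-quasi-polynomial nullcone-separation degree of the power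
trace inside the window), then the registered `stub_wideGen` (conclusion verbatim, negated) fails.
[cite: BurgisserIkenmeyer2017, §3.3] -/
theorem not_wideGen_of_late_const
    (hlate : ∃ c : ℕ, ∀ c₀ : ℕ, ∃ m e : ℕ, 1 ≤ m ∧ 1 ≤ e ∧ m + e ≤ 2 ^ ((Nat.log 2 m + c) ^ c) ∧
      (∃ k : ℕ, 0 < k ∧
        highestWeightSpace (orbitCoordRep (powFormLex ℂ (m + e) m) m) (fun _ => -(k : ℤ)) ≠ ⊥) ∧
      ∀ k : ℕ, 0 < k →
        highestWeightSpace (orbitCoordRep (powFormLex ℂ (m + e) m) m) (fun _ => -(k : ℤ)) ≠ ⊥ →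
          (m : ℤ) * 2 ^ ((Nat.log 2 m + c₀) ^ c₀) < (k : ℤ) * (((m + e) * (m + e) : ℕ) : ℤ)) :
    ¬ (∀ c : ℕ, ∃ c₀ : ℕ, ∀ m e : ℕ, 1 ≤ m → m + e ≤ 2 ^ ((Nat.log 2 m + c) ^ c) →
      ∀ ι : MatIdx m → MatIdx (m + e), StrictMono ι → IsUpperSet (Set.range ι) →
        ∀ χ : Weight (MatIdx (m + e)), (∃ x, x ∉ Set.range ι ∧ χ x ≠ 0) →
          Module.finrank ℂ (↥(highestWeightSpace (orbitCoordRep (powFormLex ℂ (m + e) m) m) (χ)) ⧸ Submodule.comap (highestWeightSpace (orbitCoordRep (powFormLex ℂ (m + e) m) m) (χ)).subtype (⨆ p : Weight (MatIdx (m + e)) × Weight (MatIdx (m + e)), ⨆ (_ : p.1 + p.2 = (χ) ∧ p.1 ≠ 0 ∧ p.2 ≠ 0), highestWeightSpace (orbitCoordRep (powFormLex ℂ (m + e) m) m) p.1 * highestWeightSpace (orbitCoordRep (powFormLex ℂ (m + e) m) m) p.2)) ≠ 0 →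
            -(Weight.size χ) ≤ (m : ℤ) * 2 ^ ((Nat.log 2 m + c₀) ^ c₀)) := by
  intro hW
  obtain ⟨c, hc⟩ := hlate
  obtain ⟨c₀, hc₀⟩ := wideGen_bounds_least_const hW c
  obtain ⟨m, e, hm, he, hwin, hex, hall⟩ := hc c₀
  obtain ⟨k, hk, hocc, -, hle⟩ := hc₀ m e hm he hwin hex
  exact absurd hle (not_le.mpr (hall k hk hocc))

/-- **… and refutes K2** (`PowGenDegreeQP`, stmt-ValiantsHypothesis-11655): K2 contains `stub_wideGen`
(`powGenDegreeQP_iff_slice_and_wide`). [cite: BurgisserIkenmeyer2017, §3.3] -/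
theorem not_powGenDegreeQP_of_late_const
    (hlate : ∃ c : ℕ, ∀ c₀ : ℕ, ∃ m e : ℕ, 1 ≤ m ∧ 1 ≤ e ∧ m + e ≤ 2 ^ ((Nat.log 2 m + c) ^ c) ∧
      (∃ k : ℕ, 0 < k ∧
        highestWeightSpace (orbitCoordRep (powFormLex ℂ (m + e) m) m) (fun _ => -(k : ℤ)) ≠ ⊥) ∧
      ∀ k : ℕ, 0 < k →
        highestWeightSpace (orbitCoordRep (powFormLex ℂ (m + e) m) m) (fun _ => -(k : ℤ)) ≠ ⊥ →
          (m : ℤ) * 2 ^ ((Nat.log 2 m + c₀) ^ c₀) < (k : ℤ) * (((m + e) * (m + e) : ℕ) : ℤ)) :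
    ¬ PowGenDegreeQP :=
  fun hK2 => not_wideGen_of_late_const hlate (powGenDegreeQP_iff_slice_and_wide.mp hK2).2

end Stub

end

end Summit.ValiantsHypothesis.ValiantsHypothesis.Theorems.GeneratorObstructions.PowGenDegreeQP
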